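import Literature.Geometry.Symplectic.OrigamiCutGlueMaps
import Literature.Topology.FourManifolds.GluingConstruction
import HarnessLib

/-!
# Gluing a side of the fold to the cut space: the cut piece is a compact connected Hausdorff
# 4-manifold

Proofs companion of `OrigamiUnfolding.lean` (the named fact
`Literature.Geometry.Symplectic.exists_symplecticCutPieces_of_isOrigamiForm`, Cannas da
Silva–Guillemin–Pires, *Symplectic Origami*, IMRN 2011 = arXiv:0909.4065, Prop. 2.8), step (S3)
continued from `OrigamiCutGlueMaps.lean` (setting `D : CutCollarData M N`, gluing maps `glueFun`
/ `unglueFun`).  Here they are packaged as an `OpenPartialHomeomorph` `D.glueHomeo` between the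
open side `V` and the disc bundle `cutDisc δ` of the cut space, and fed to the tree's open gluing
of manifolds (`Literature.Topology.FourManifolds.SmoothGlueData`, Kosinski VI.1) as
`D.glueData`; the glued space `D.Piece = V ∪_glue cutDisc δ` is the CUT PIECE `M₀⁺` of Prop. 2.8
("`M₀⁺ = M⁺ ∪ μ⁻¹(0)/S¹` glued along `j⁺`; when the original origami manifold is compact, the
symplectic cut space is also compact").  We prove:

* `D.glueHomeo`, `D.glueData`, `D.Piece` (a `C^∞` manifold modelled on `ℝ⁴`, instances from
  `GluingConstruction.lean`);
* `D.t2Space_piece` — **Hausdorff**: the graph of the gluing map is closed in `V × cutDisc δ`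
  (over the target it is the graph of the continuous `unglueFun`; a point `(a, b)` with `b` on
  the zero section is separated from the graph by a neighbourhood of `a` disjoint from the
  compact `c (N × {0}) ⊆ Vᶜ` and a thin disc bundle, by the tube lemma);
* `D.compactSpace_piece` — **compact** (for compact `M`): covered by the images of the compact
  sets `closure V ∖ c (N × (-δ/2, δ/2))` and `{|w|² ≤ (δ/2)²}`;
* `D.connectedSpace_piece` (for connected `V`, `N`), `D.secondCountableTopology_piece`.

Everything here is proved; the definitions are explicit constructions; no facts.

## References

* A. Cannas da Silva, V. Guillemin, A. R. Pires, *Symplectic Origami*, IMRN 2011 =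
  arXiv:0909.4065, proof of Prop. 2.8, Def. 2.11 ff. [CannasdasilvaGuilleminPires2010]
* A. A. Kosinski, *Differential Manifolds* (1993), VI.1 (gluing of manifolds).
-/

noncomputable section

open scoped Manifold ContDiff Topology
open Set Function Filter TopologicalSpace
open _root_.Topology
open Literature.Geometry.Kaehler Literature.Geometry.Manifold
open Literature.Topology.FourManifolds (SmoothGlueData)

namespace Literature.Geometry.Symplectic

namespace CutCollarData

universe u

variable {M : Type u} [TopologicalSpace M] [ChartedSpace (EuclideanSpace ℝ (Fin 4)) M]
  [IsManifold (𝓡 4) ∞ M]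
  {N : Type} [TopologicalSpace N] [ChartedSpace (EuclideanSpace ℝ (Fin 3)) N]
  [IsManifold (𝓡 3) ∞ N] [T2Space N] [Nonempty N] [MulAction Circle N] (D : CutCollarData M N)

/-! ### The gluing partial homeomorphism and the glued piece -/

/-- **The gluing partial homeomorphism** `V ⊇ c (N × (0, δ)) ≅ cutDisc δ ∖ (zero section)`.
[cite: CannasdasilvaGuilleminPires2010, Prop. 2.8] -/
def glueHomeo : OpenPartialHomeomorph D.V D.B where
  toFun := D.glueFun
  invFun := D.unglueFun
  source := D.glueSource
  target := D.glueTarget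
  map_source' := fun _ ha => D.glueFun_mem_target ha
  map_target' := fun b _ => D.unglueFun_mem_source b
  left_inv' := fun _ ha => D.unglueFun_glueFun ha
  right_inv' := fun _ hb => D.glueFun_unglueFun hb
  open_source := D.isOpen_glueSource
  open_target := D.isOpen_glueTarget
  continuousOn_toFun := D.continuousOn_glueFun
  continuousOn_invFun := D.continuousOn_unglueFun

/-- The gluing map is `glueFun`. [folklore] -/
@[simp] theorem glueHomeo_apply (a : D.V) : D.glueHomeo a = D.glueFun a := rfl

/-- The inverse gluing map is `unglueFun`. [folklore] -/
@[simp] theorem glueHomeo_symm_apply (b : D.B) : D.glueHomeo.symm b = D.unglueFun b := rfl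

/-- The source of the gluing. [folklore] -/
@[simp] theorem glueHomeo_source : D.glueHomeo.source = D.glueSource := rfl

/-- The target of the gluing. [folklore] -/
@[simp] theorem glueHomeo_target : D.glueHomeo.target = D.glueTarget := rfl

/-- **The gluing datum** of the side `V` (model `𝓡 4`) and the disc bundle `cutDisc δ` of the cut
space (model `𝓡 (3+1)`), glued into a manifold modelled on `ℝ⁴`.
[cite: CannasdasilvaGuilleminPires2010, Prop. 2.8] -/
def glueData : letI := D.csB; SmoothGlueData (𝓡 4) (𝓡 (3 + 1)) D.V D.B (EuclideanSpace ℝ (Fin 4)) :=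
  letI := D.csB
  { glue := D.glueHomeo
    contMDiffOn_glue := D.contMDiffOn_glueFun
    contMDiffOn_glue_symm := D.contMDiffOn_unglueFun
    linA := ContinuousLinearEquiv.refl ℝ (EuclideanSpace ℝ (Fin 4))
    linB := ContinuousLinearEquiv.refl ℝ (EuclideanSpace ℝ (Fin 4)) }

/-- **The cut piece** `M₀⁺ = V ∪_glue cutDisc δ` (Prop. 2.8). [cite: CannasdasilvaGuilleminPires2010, Prop. 2.8] -/
def Piece : Type u := letI := D.csB; D.glueData.Glued

/-- The topology of the cut piece (the pushout topology). [folklore] -/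
instance instTopologicalSpacePiece : TopologicalSpace D.Piece :=
  letI := D.csB; inferInstanceAs (TopologicalSpace D.glueData.Glued)

/-- The charted-space structure of the cut piece, modelled on `ℝ⁴`. [folklore] -/
instance instChartedSpacePiece : ChartedSpace (EuclideanSpace ℝ (Fin 4)) D.Piece := by
  letI := D.csB
  haveI := isManifold_cutSpace D.smooth_act D.free_act
  exact inferInstanceAs (ChartedSpace (EuclideanSpace ℝ (Fin 4)) D.glueData.Glued)

/-- **The cut piece is a `C^∞` `4`-manifold** (Kosinski VI.1). [cite: CannasdasilvaGuilleminPires2010, Prop. 2.8] -/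
instance instIsManifoldPiece : IsManifold (𝓡 4) ∞ D.Piece := by
  letI := D.csB
  haveI := isManifold_cutSpace D.smooth_act D.free_act
  exact inferInstanceAs (IsManifold 𝓘(ℝ, EuclideanSpace ℝ (Fin 4)) ∞ D.glueData.Glued)

/-- The structure map of the side into the cut piece. [folklore] -/
def inV : D.V → D.Piece := letI := D.csB; D.glueData.inl

/-- The structure map of the disc bundle into the cut piece. [folklore] -/
def inB : D.B → D.Piece := letI := D.csB; D.glueData.inr

/-- `inV a = inB b ↔ a ∈ source ∧ glue a = b`. [folklore] -/
theorem inV_eq_inB_iff {a : D.V} {b : D.B} : D.inV a = D.inB b ↔ a ∈ D.glueSource ∧ D.glueFun a = b := by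
  letI := D.csB
  exact D.glueData.inl_eq_inr_iff

/-- `inV` is injective. [folklore] -/
theorem inV_injective : Injective D.inV := by letI := D.csB; exact D.glueData.inl_injective

/-- `inB` is injective. [folklore] -/
theorem inB_injective : Injective D.inB := by letI := D.csB; exact D.glueData.inr_injective

/-- Every point of the piece comes from `V` or from the disc bundle. [folklore] -/
theorem exists_inV_or_inB (p : D.Piece) : (∃ a, D.inV a = p) ∨ ∃ b, D.inB b = p := by
  letI := D.csB; exact D.glueData.exists_inl_or_inr p

/-- `inV` is an open embedding. [folklore] -/
theorem isOpenEmbedding_inV : IsOpenEmbedding D.inV := by letI := D.csB; exact D.glueData.isOpenEmbedding_inl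

/-- `inB` is an open embedding. [folklore] -/
theorem isOpenEmbedding_inB : IsOpenEmbedding D.inB := by letI := D.csB; exact D.glueData.isOpenEmbedding_inr

/-- `inV` is `C^∞`. [folklore] -/
theorem contMDiff_inV : ContMDiff (𝓡 4) (𝓡 4) ∞ D.inV := by
  letI := D.csB
  haveI := isManifold_cutSpace D.smooth_act D.free_act
  exact D.glueData.contMDiff_inl

/-- `inB` is `C^∞`. [folklore] -/
theorem contMDiff_inB : letI := D.csB; ContMDiff (𝓡 (3 + 1)) (𝓡 4) ∞ D.inB := by
  letI := D.csB
  haveI := isManifold_cutSpace D.smooth_act D.free_act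
  exact D.glueData.contMDiff_inr

/-- `inV` is a smooth embedding. [folklore] -/
theorem isSmoothEmbedding_inV : Manifold.IsSmoothEmbedding (𝓡 4) (𝓡 4) ∞ D.inV := by
  letI := D.csB
  haveI := isManifold_cutSpace D.smooth_act D.free_act
  exact D.glueData.isSmoothEmbedding_inl

/-- `inB` is a smooth embedding. [folklore] -/
theorem isSmoothEmbedding_inB : letI := D.csB; Manifold.IsSmoothEmbedding (𝓡 (3 + 1)) (𝓡 4) ∞ D.inB := by
  letI := D.csB
  haveI := isManifold_cutSpace D.smooth_act D.free_act
  exact D.glueData.isSmoothEmbedding_inr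

/-- `inB` composed with a smooth embedding is a smooth embedding. [folklore] -/
theorem isSmoothEmbedding_inB_comp {EQ : Type*} [NormedAddCommGroup EQ] [NormedSpace ℝ EQ]
    {HQ : Type*} [TopologicalSpace HQ] {IQ : ModelWithCorners ℝ EQ HQ} {Q : Type*}
    [TopologicalSpace Q] [ChartedSpace HQ Q] {g : Q → D.B}
    (hg : letI := D.csB; Manifold.IsSmoothEmbedding IQ (𝓡 (3 + 1)) ∞ g) :
    Manifold.IsSmoothEmbedding IQ (𝓡 4) ∞ (D.inB ∘ g) := by
  letI := D.csB
  haveI := isManifold_cutSpace D.smooth_act D.free_act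
  exact D.glueData.isSmoothEmbedding_inr_comp hg

/-- On the source, `inV a = inB (glue a)`. [folklore] -/
theorem inB_glueFun {a : D.V} (ha : a ∈ D.glueSource) : D.inB (D.glueFun a) = D.inV a := by
  letI := D.csB; exact D.glueData.inr_glue ha

/-! ### Hausdorffness -/

omit [IsManifold (𝓡 4) ∞ M] [IsManifold (𝓡 3) ∞ N] [T2Space N] [Nonempty N] in
/-- The fold image `c (N × {0})` is compact when `N` is. [folklore] -/
theorem isCompact_image_zero [CompactSpace N] : IsCompact (D.c '' (univ ×ˢ {0})) := by
  have hsub : (univ ×ˢ {0} : Set (N × ℝ)) ⊆ D.band := by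
    rintro ⟨n, t⟩ ⟨-, ht⟩
    rw [mem_singleton_iff] at ht
    subst ht
    exact D.mk_mem_band ⟨by linarith [D.δ_pos], D.δ_pos⟩
  exact (isCompact_univ.prod isCompact_singleton).image_of_continuousOn (D.smooth_c.continuousOn.mono hsub)

omit [IsManifold (𝓡 4) ∞ M] [IsManifold (𝓡 3) ∞ N] [T2Space N] [Nonempty N] in
/-- The fold image misses `V`. [folklore] -/
theorem image_zero_disjoint : Disjoint (D.c '' (univ ×ˢ {0})) (D.V : Set M) := by
  rw [Set.disjoint_left]
  rintro _ ⟨⟨n, t⟩, ⟨-, ht⟩, rfl⟩ hV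
  rw [mem_singleton_iff] at ht
  subst ht
  exact D.c_not_mem n 0 ⟨by linarith [D.δ_pos], le_refl _⟩ hV

omit [IsManifold (𝓡 4) ∞ M] in
/-- **The graph of the gluing map is closed** in `V × cutDisc δ`. [folklore] -/
theorem isClosed_graph [T2Space M] [CompactSpace N] :
    IsClosed {p : D.V × D.B | p.1 ∈ D.glueSource ∧ D.glueFun p.1 = p.2} := by
  rw [← isOpen_compl_iff, isOpen_iff_forall_mem_open]
  rintro ⟨a, b⟩ hab
  simp only [mem_compl_iff, mem_setOf_eq] at hab
  by_cases hb : b ∈ D.glueTarget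
  · -- over the target the graph is the graph of the continuous `unglueFun`
    refine ⟨{p : D.V × D.B | p.2 ∈ D.glueTarget ∧ p.1 ≠ D.unglueFun p.2}, ?_, ?_, ?_⟩
    · rintro ⟨a', b'⟩ ⟨hb', hne⟩ ⟨ha', hglue⟩
      apply hne
      simp only at hglue ⊢
      rw [← hglue, D.unglueFun_glueFun ha']
    · have hc : ContinuousOn (fun p : D.V × D.B => (p.1, D.unglueFun p.2)) (Prod.snd ⁻¹' D.glueTarget) :=
        continuous_fst.continuousOn.prodMk (D.continuousOn_unglueFun.comp continuous_snd.continuousOn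
          fun p hp => hp)
      have hopen : IsOpen ((Prod.snd ⁻¹' D.glueTarget) ∩ (fun p : D.V × D.B => (p.1, D.unglueFun p.2)) ⁻¹'
          {q : D.V × D.V | q.1 ≠ q.2}) :=
        hc.isOpen_inter_preimage (D.isOpen_glueTarget.preimage continuous_snd) isClosed_diagonal.isOpen_compl
      exact hopen
    · refine ⟨hb, fun h => hab ⟨?_, ?_⟩⟩
      · have h' : a = D.unglueFun b := h
        rw [h']; exact D.unglueFun_mem_source b
      · have h' : a = D.unglueFun b := h
        rw [h']; exact D.glueFun_unglueFun hb
  · -- `b` on the zero section: separate `a` from the compact fold image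
    have hb0 : cutNormSq (b : CutSpace 3 N) = 0 := by
      by_contra h; exact hb h
    have haK : (a : M) ∉ D.c '' (univ ×ˢ {0}) := fun h =>
      (Set.disjoint_left.1 D.image_zero_disjoint) h a.2
    obtain ⟨O, U₀, hO, hU₀, hKO, haU₀, hOU⟩ := SeparatedNhds.of_isCompact_isCompact
      D.isCompact_image_zero isCompact_singleton (disjoint_singleton_right.2 haK)
    have haU : (a : M) ∈ U₀ := haU₀ rfl
    -- tube lemma: `c (N × (-ε, ε)) ⊆ O`
    have hn : IsOpen (D.band ∩ D.c ⁻¹' O) := D.smooth_c.continuousOn.isOpen_inter_preimage D.isOpen_band hO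
    have hsub : (univ : Set N) ×ˢ ({0} : Set ℝ) ⊆ D.band ∩ D.c ⁻¹' O := by
      rintro ⟨n, t⟩ ⟨-, ht⟩
      rw [mem_singleton_iff] at ht; subst ht
      exact ⟨D.mk_mem_band ⟨by linarith [D.δ_pos], D.δ_pos⟩, hKO ⟨(n, 0), ⟨mem_univ _, rfl⟩, rfl⟩⟩
    obtain ⟨u, v, -, hv, hNu, h0v, huv⟩ := generalized_tube_lemma isCompact_univ isCompact_singleton hn hsub
    obtain ⟨ε, hε, hεv⟩ := Metric.mem_nhds_iff.1 (hv.mem_nhds (h0v rfl))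
    -- the neighbourhood
    refine ⟨{p : D.V × D.B | (p.1 : M) ∈ U₀ ∧ cutNormSq (p.2 : CutSpace 3 N) < ε ^ 2}, ?_, ?_, ?_⟩
    · rintro ⟨a', b'⟩ ⟨ha'U, hb'ε⟩ ⟨ha', hglue⟩
      obtain ⟨⟨n, t⟩, hnt, ha'eq⟩ := ha'
      have hmem := D.mk_mem_halfBand (n := n) hnt.2
      have hV : D.c (n, t) ∈ (D.V : Set M) := D.image_halfBand_subset ⟨_, hmem, rfl⟩
      have haeq : a' = ⟨D.c (n, t), hV⟩ := Subtype.ext ha'eq.symm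
      subst haeq
      simp only at hglue hb'ε ha'U
      rw [← hglue, D.glueFun_apply hnt.2 hV, cutNormSq_cutSlice] at hb'ε
      have ht : t < ε := lt_of_pow_lt_pow_left₀ 2 hε.le hb'ε
      have htv : t ∈ v := hεv (by rw [Metric.mem_ball, dist_zero_right, Real.norm_eq_abs, abs_of_pos hnt.2.1]; exact ht)
      have hcO : D.c (n, t) ∈ O := (huv ⟨hNu (mem_univ n), htv⟩).2
      exact Set.disjoint_left.1 hOU hcO ha'U
    · exact (hU₀.preimage (continuous_subtype_val.comp continuous_fst)).inter
        ((isOpen_Iio.preimage continuous_cutNormSq).preimage (continuous_subtype_val.comp continuous_snd))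
    · exact ⟨haU, by rw [hb0]; positivity⟩

/-- **The cut piece is Hausdorff.** [cite: CannasdasilvaGuilleminPires2010, Prop. 2.8] -/
theorem t2Space_piece [T2Space M] [CompactSpace N] : T2Space D.Piece := by
  letI := D.csB
  haveI : T2Space (CutSpace 3 N) := by
    haveI := ProdC.continuousSMul_prodC D.smooth_act
    infer_instance
  exact D.glueData.t2Space_of_isClosed_graph D.isClosed_graph

/-! ### Compactness -/

/-- The compact core of the side: `V` minus the thin band `c (N × (-δ/2, δ/2))`, whose image
in `M` is `closure V ∖ c (N × (-δ/2, δ/2))`. [folklore] -/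
def coreV : Set D.V := {a | (a : M) ∉ D.c '' (univ ×ˢ Ioo (-(D.δ / 2)) (D.δ / 2))}

/-- The compact core of the disc bundle: `{|w|² ≤ (δ/2)²}`. [folklore] -/
def coreB : Set D.B := {b | cutNormSq (b : CutSpace 3 N) ≤ (D.δ / 2) ^ 2}

omit [T2Space N] [Nonempty N] in
/-- The thin band is open. [folklore] -/
theorem isOpen_image_thinBand : IsOpen (D.c '' (univ ×ˢ Ioo (-(D.δ / 2)) (D.δ / 2))) := by
  have hsub : (univ ×ˢ Ioo (-(D.δ / 2)) (D.δ / 2) : Set (N × ℝ)) ⊆ D.band := by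
    rintro ⟨n, t⟩ ⟨-, ht⟩
    exact D.mk_mem_band ⟨by linarith [ht.1, D.δ_pos], by linarith [ht.2, D.δ_pos]⟩
  exact isOpen_image_of_bijective_mfderiv (isOpen_univ.prod isOpen_Ioo) (D.smooth_c.mono hsub)
    fun x hx => D.bij_c x.1 x.2 (hsub hx).2

omit [IsManifold (𝓡 4) ∞ M] [IsManifold (𝓡 3) ∞ N] [T2Space N] [Nonempty N] in
/-- The image of the core of the side is `closure V` minus the thin band; it is closed. [folklore] -/
theorem image_coreV_eq : (Subtype.val '' D.coreV : Set M) =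
    closure (D.V : Set M) ∩ (D.c '' (univ ×ˢ Ioo (-(D.δ / 2)) (D.δ / 2)))ᶜ := by
  ext x
  constructor
  · rintro ⟨a, ha, rfl⟩
    exact ⟨subset_closure a.2, ha⟩
  · rintro ⟨hxc, hxW⟩
    have hxV : x ∈ (D.V : Set M) := by
      rcases D.closure_subset hxc with h | ⟨⟨n, t⟩, ⟨-, ht⟩, rfl⟩
      · exact h
      · exfalso
        rw [mem_singleton_iff] at ht; subst ht
        exact hxW ⟨(n, 0), ⟨mem_univ _, by
          constructor <;> linarith [D.δ_pos]⟩, rfl⟩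
    exact ⟨⟨x, hxV⟩, hxW, rfl⟩

omit [T2Space N] [Nonempty N] in
/-- The core of the side is compact (for compact `M`). [folklore] -/
theorem isCompact_coreV [CompactSpace M] : IsCompact D.coreV := by
  rw [Subtype.isCompact_iff, image_coreV_eq]
  exact (isClosed_closure.inter D.isOpen_image_thinBand.isClosed_compl).isCompact

omit [IsManifold (𝓡 4) ∞ M] [IsManifold (𝓡 3) ∞ N] [T2Space N] [Nonempty N] in
/-- The core of the disc bundle is compact (for compact `N`). [folklore] -/
theorem isCompact_coreB [CompactSpace N] : IsCompact D.coreB := by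
  rw [Subtype.isCompact_iff]
  have heq : (Subtype.val '' D.coreB : Set (CutSpace 3 N)) = {q | cutNormSq q ≤ (D.δ / 2) ^ 2} := by
    ext q
    constructor
    · rintro ⟨b, hb, rfl⟩; exact hb
    · intro hq
      have hqB : q ∈ (D.B : Set (CutSpace 3 N)) := by
        show cutNormSq q < D.δ ^ 2
        have h4 : (D.δ / 2) ^ 2 < D.δ ^ 2 := by nlinarith [D.δ_pos]
        exact lt_of_le_of_lt hq h4
      exact ⟨⟨q, hqB⟩, hq, rfl⟩
  rw [heq]
  refine (isCompact_image_cutMk_closedBall (k := 3) (N := N) (D.δ / 2)).of_isClosed_subset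
    (isClosed_Iic.preimage continuous_cutNormSq) ?_
  intro q hq
  exact mem_image_cutMk_closedBall_of_cutNormSq_le (half_pos D.δ_pos).le hq

/-- **The cut piece is compact** (for compact `M`, `N`). [cite: CannasdasilvaGuilleminPires2010, Prop. 2.8] -/
theorem compactSpace_piece [CompactSpace M] [CompactSpace N] : CompactSpace D.Piece := by
  letI := D.csB
  refine D.glueData.compactSpace_of_forall_not_mem D.isCompact_coreV D.isCompact_coreB ?_ ?_
  · -- a point of `V` in the thin band is a glued collar point with small height
    intro a ha
    simp only [coreV, mem_setOf_eq, not_not] at ha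
    obtain ⟨⟨n, t⟩, ⟨-, ht⟩, hnt⟩ := ha
    have htpos : 0 < t := by
      by_contra h
      push Not at h
      exact D.c_not_mem n t ⟨by linarith [ht.1, D.δ_pos], h⟩ (hnt ▸ a.2)
    have ht' : t ∈ Ioo 0 D.δ := ⟨htpos, by linarith [ht.2, D.δ_pos]⟩
    have hsrc : a ∈ D.glueSource := ⟨(n, t), D.mk_mem_halfBand ht', hnt⟩
    refine ⟨hsrc, ?_⟩
    have hV : D.c (n, t) ∈ (D.V : Set M) := D.c_mem n t ht'
    have haeq : a = ⟨D.c (n, t), hV⟩ := Subtype.ext hnt.symm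
    subst haeq
    show cutNormSq (D.glueFun ⟨D.c (n, t), hV⟩ : CutSpace 3 N) ≤ (D.δ / 2) ^ 2
    rw [D.glueFun_apply ht' hV, cutNormSq_cutSlice]
    exact pow_le_pow_left₀ htpos.le ht.2.le 2
  · -- a point of the disc bundle far from the zero section unglues outside the thin band
    intro b hb
    simp only [coreB, mem_setOf_eq, not_le] at hb
    have hb0 : cutNormSq (b : CutSpace 3 N) ≠ 0 := (lt_of_le_of_lt (sq_nonneg _) hb).ne'
    refine ⟨hb0, ?_⟩
    show (D.unglueFun b : M) ∉ D.c '' (univ ×ˢ Ioo (-(D.δ / 2)) (D.δ / 2))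
    rw [D.coe_unglueFun, D.liftB_of_ne hb0]
    rintro ⟨⟨n', t'⟩, ⟨-, ht'⟩, heq⟩
    obtain ⟨hsq, hpos⟩ := cutUnslice_snd_sq (k := 3) hb0
    have hlt : (cutUnslice (b : CutSpace 3 N)).2 < D.δ := by
      have h := b.2
      change cutNormSq (b : CutSpace 3 N) < D.δ ^ 2 at h
      rw [← hsq] at h
      exact lt_of_pow_lt_pow_left₀ 2 D.δ_pos.le h
    have hmem : cutUnslice (b : CutSpace 3 N) ∈ D.band :=
      ⟨mem_univ _, by linarith, hlt⟩
    have hmem' : ((n', t') : N × ℝ) ∈ D.band :=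
      D.mk_mem_band ⟨by linarith [ht'.1, D.δ_pos], by linarith [ht'.2, D.δ_pos]⟩
    have heq' := D.injOn_c hmem' hmem heq
    have ht'eq : t' = (cutUnslice (b : CutSpace 3 N)).2 := congrArg Prod.snd heq'
    rw [← ht'eq] at hsq
    nlinarith [ht'.1, ht'.2, hsq]

/-! ### Second countability and connectedness -/

/-- The cut piece is second countable (compact manifold). [folklore] -/
theorem secondCountableTopology_piece [CompactSpace M] [CompactSpace N] : SecondCountableTopology D.Piece := by
  letI := D.csB
  haveI := isManifold_cutSpace D.smooth_act D.free_act
  haveI := D.compactSpace_piece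
  haveI : SigmaCompactSpace D.glueData.Glued := inferInstanceAs (SigmaCompactSpace D.Piece)
  exact D.glueData.secondCountableTopology

omit [IsManifold (𝓡 4) ∞ M] [IsManifold (𝓡 3) ∞ N] [T2Space N] [Nonempty N] in
/-- The disc bundle is connected when `N` is. [folklore] -/
theorem isConnected_B [ConnectedSpace N] : IsConnected (D.B : Set (CutSpace 3 N)) := by
  have heq : (D.B : Set (CutSpace 3 N)) = (fun x : N × ℂ => (cutMk x.1 x.2 : CutSpace 3 N)) ''
      (univ ×ˢ Metric.ball (0 : ℂ) D.δ) := by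
    ext q
    constructor
    · intro hq
      obtain ⟨n, w, rfl⟩ := cutMk_surjective q
      refine ⟨(n, w), ⟨mem_univ _, ?_⟩, rfl⟩
      rw [Metric.mem_ball, dist_zero_right]
      exact (cutMk_mem_cutDisc_iff D.δ_pos).1 hq
    · rintro ⟨⟨n, w⟩, ⟨-, hw⟩, rfl⟩
      rw [Metric.mem_ball, dist_zero_right] at hw
      exact (cutMk_mem_cutDisc_iff D.δ_pos).2 hw
  rw [heq]
  exact (isConnected_univ.prod ((convex_ball (0 : ℂ) D.δ).isConnected
    ⟨0, Metric.mem_ball_self D.δ_pos⟩)).image _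
    ((continuous_circleQuotientMk.comp ProdC.continuous_mkUncurry).continuousOn)

/-- **The cut piece is connected** when `V` and `N` are. [cite: CannasdasilvaGuilleminPires2010, Prop. 2.8] -/
theorem connectedSpace_piece [ConnectedSpace N] (hV : IsConnected (D.V : Set M)) : ConnectedSpace D.Piece := by
  letI := D.csB
  haveI : ConnectedSpace D.V := isConnected_iff_connectedSpace.1 hV
  haveI : ConnectedSpace D.B := isConnected_iff_connectedSpace.1 D.isConnected_B
  -- a common point: the collar point `c (n₀, δ/2)`
  obtain ⟨n₀⟩ := (inferInstance : Nonempty N)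
  have ht : D.δ / 2 ∈ Ioo 0 D.δ := ⟨half_pos D.δ_pos, half_lt_self D.δ_pos⟩
  have hV₀ : D.c (n₀, D.δ / 2) ∈ (D.V : Set M) := D.c_mem n₀ _ ht
  have hsrc : (⟨D.c (n₀, D.δ / 2), hV₀⟩ : D.V) ∈ D.glueSource := ⟨_, D.mk_mem_halfBand ht, rfl⟩
  have key : IsConnected (Set.univ : Set D.glueData.Glued) := by
    rw [← D.glueData.range_inl_union_range_inr]
    exact IsConnected.union
      ⟨D.glueData.inl ⟨D.c (n₀, D.δ / 2), hV₀⟩, mem_range_self _, ⟨_, D.glueData.inr_glue hsrc⟩⟩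
      (isConnected_range D.glueData.isOpenEmbedding_inl.continuous)
      (isConnected_range D.glueData.isOpenEmbedding_inr.continuous)
  exact connectedSpace_iff_univ.2 key

end CutCollarData

end Literature.Geometry.Symplectic

end
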